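import Summits.NavierStokesRegularity.FluidComputer.PalasekTowerMechanismDoorAtScaled
import Literature.Analysis.FluidPDE.AxisymmetricEuler
import Literature.Analysis.FluidPDE.AxisymmetricVorticityTransport

/-!
# The STERILE mechanism door in ARBITRARY UNITS: free start time, centre ON THE AXIS, speed scale and viscosity
# (the kit-units reading of stub D2 `SterileMechanismDoorT`; abstract conclusion, Theses-free)

Cell `ns-blowup`, seat `ns-blowup-fc-prover-2` (g11; D-0074 GROUP C «BRIDGE SUPPORT»). Route `PalasekTowerBreakdown` (rev 19):
crux stmt-NavierStokesRegularity-20303 `EpisodeBaseT`, heredity pair 20304 / 20305; stub D2 of the strategist's line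
`Cruxes/EpisodeBaseT/Lines/doormirror.lean`. The sterile twin of ecbridge-3's `PalasekTowerMechanismDoorAtScaled`
(`MechanismDoorAt.episodeBaseGAt_of_scaledFreeRun`, p553549): SAME dictionary, SAME proof, two extra hypotheses (the release
slice is axisymmetric swirl free, the centre lies on the axis) transported through the rescaling. LABEL: E–C typing (KERNEL: one
definition with body — the sterile door at `R` with an ABSTRACT conclusion `C : Prop`, so that this file imports no route file —
and theorems). WHAT THIS IS NOT: not Navier–Stokes evidence — no run of any window is exhibited; `C` is whatever the
Theorems-side instance feeds (`NoSwirlRungGAt R 1` in `Theorems/PalasekTowerBreakdownEpisodeBaseTSterileMechanismDoor.lean`).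

## The point

`SterileDoorAt R C`: «for every AXISYMMETRIC SWIRL-FREE smooth divergence-free `W` with `tsupport W ⊆ B̄(0, ρ)` (`ρ ≥ 0`),
speed `< Y₀(R)`, and every classical finite-energy free run on `[1, τfirstAt R]` from `W` under `(5/3)Y₁(R) − η` showing the
three level-`1` faces of `R` with margin `η > 0` inside `‖x‖ ≤ ρ` — `C`» (the binders of `StrainDoor.MechanismDoorAt R` plus
sterility). **`SterileDoorAt.of_scaledFreeRun`**: under `SterileDoorAt R C`, a classical free run with viscosity `ν' > 0` on a
kit window `[t_a, t_a + κ²ν'·wfirstAt R]` whose release slice `v t_a` is AXISYMMETRIC SWIRL FREE, supported in `B̄(x₀, ρ)` with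
`x₀` ON THE AXIS, `κ‖v t_a‖ < Y₀(R)`, under the cap `κ‖v‖ ≤ (5/3)Y₁(R) − η`, showing at `t_a + T` in `B̄(x₀, ρ)` the speed
`κ‖v‖ ≥ Y₁ + η`, the gradient `κ²ν'‖Dv‖ ≥ A₁ + η` and a loop in a ball of radius `κν'/N₁` of speed `≤ 8πκν'/N₁` and
circulation `≥ ν'(N₁^{β−2} + η)` — gives `C`. (The rescaled datum `y ↦ κ v t_a (x₀ + κν' y)` is axisymmetric swirl free:
`isAxisymmetric_smul_comp_axis`, `hasNoSwirl_smul_comp_axis`.) At `tuned` in the cell's kit normalisation: window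
`169.85/m²`, faces `2.0705 m` / `3.482 m²` / `1.231` in radius `0.5946/m`, cap `3.45 m` (READING 2 of DIRECTOR-NS #74; the
STERILE-DOOR test PREREG-0b scores exactly these faces for sterile release slices).

References: J. Leray, Acta Math. 63 (1934) §20 [cite: Leray1934, §20]; S. Palasek, arXiv:2605.13827 §4
[cite: Palasek2026ElementaryModel, §4]; A. J. Majda, A. L. Bertozzi (CUP 2002) §2.3.3 [cite: MajdaBertozziCUP2002, §1.8 Prop. 1.16].
-/

noncomputable section

namespace Summit.NavierStokesRegularity.FluidComputer.PalasekTowerClayBridge.StrainDoor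

open Set MeasureTheory Metric Function
open scoped ENNReal NNReal ContDiff RealInnerProductSpace
open Literature.Analysis Literature.Analysis.FluidPDE

/-! ## §1 The sterile door at `R` with an abstract conclusion -/

/-- **THE STERILE MECHANISM DOOR AT THE RATES `R`, ABSTRACT CONCLUSION `C`**: the binders of `MechanismDoorAt R` preceded by
`IsAxisymmetric W`, `HasNoSwirl W`, concluding `C`. With `C := NoSwirlRungGAt R 1` this is stub D2 of the line «doormirror» at
`R` (the instance is Theorems-side). [cite: Palasek2026ElementaryModel, §4] -/
def SterileDoorAt (R : TowerRates) (C : Prop) : Prop :=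
  ∀ ⦃W : EuclideanSpace ℝ (Fin 3) → EuclideanSpace ℝ (Fin 3)⦄ ⦃ρ : ℝ⦄,
    IsAxisymmetric W → HasNoSwirl W →
    ContDiff ℝ ∞ W → VectorCalculus.IsDivFree W → tsupport W ⊆ closedBall 0 ρ →
    (∀ x, ‖W x‖ < R.Y 0) → 0 ≤ ρ →
    ∀ ⦃v : ℝ → EuclideanSpace ℝ (Fin 3) → EuclideanSpace ℝ (Fin 3)⦄ ⦃q : ℝ → EuclideanSpace ℝ (Fin 3) → ℝ⦄,
      IsClassicalNSSolutionOn (Icc 1 (Host.τfirstAt R)) 1 0 v q → v 1 = W →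
      (∃ C : ℝ≥0∞, C < ⊤ ∧ ∀ t ∈ Icc (1 : ℝ) (Host.τfirstAt R), ∫⁻ x, ‖v t x‖ₑ ^ 2 ≤ C) →
      ∀ ⦃η : ℝ⦄, 0 < η →
        (∀ t ∈ Icc (1 : ℝ) (Host.τfirstAt R), ∀ x, ‖v t x‖ ≤ 5 / 3 * R.Y 1 - η) →
        (∃ x, ‖x‖ ≤ ρ ∧ R.Y 1 + η ≤ ‖v (Host.τfirstAt R) x‖) →
        (∃ x, ‖x‖ ≤ ρ ∧ R.A 1 + η ≤ ‖fderiv ℝ (v (Host.τfirstAt R)) x‖) →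
        (∃ (x : EuclideanSpace ℝ (Fin 3)) (γ : ℝ → EuclideanSpace ℝ (Fin 3)),
          ‖x‖ ≤ ρ ∧ ContDiff ℝ 1 γ ∧ γ 0 = γ 1 ∧
          (∀ s ∈ Icc (0 : ℝ) 1, γ s ∈ closedBall x (1 / R.N 1)) ∧
          (∀ s ∈ Icc (0 : ℝ) 1, ‖deriv γ s‖ ≤ 8 * Real.pi / R.N 1) ∧
          R.N 1 ^ (R.β - 2) + η ≤ circulation (v (Host.τfirstAt R)) γ) →
        C

/-! ## §2 Sterility under the dilation about a centre on the axis -/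

/-- `R_θ (x₀ + g y) = x₀ + g R_θ y` for `x₀ on the axis (rotations about the axis fix its points). [folklore] -/
theorem rotZ_axis_add_smul {x₀ : EuclideanSpace ℝ (Fin 3)} (h0 : x₀ 0 = 0) (h1 : x₀ 1 = 0) (g θ : ℝ)
    (y : EuclideanSpace ℝ (Fin 3)) : rotZ θ (x₀ + g • y) = x₀ + g • rotZ θ y := by
  have hx : rotZ θ x₀ = x₀ := by
    ext i
    fin_cases i <;> simp [h0, h1]
  rw [← rotZL_apply, map_add, map_smul, rotZL_apply, rotZL_apply, hx]

/-- **An axisymmetric slice stays axisymmetric under `y ↦ κ V(x₀ + g y)` with `x₀` on the axis.**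
[cite: MajdaBertozziCUP2002, §1.8 Prop. 1.16] -/
theorem isAxisymmetric_smul_comp_axis {V : EuclideanSpace ℝ (Fin 3) → EuclideanSpace ℝ (Fin 3)} (hV : IsAxisymmetric V)
    {x₀ : EuclideanSpace ℝ (Fin 3)} (h0 : x₀ 0 = 0) (h1 : x₀ 1 = 0) (κ g : ℝ) :
    IsAxisymmetric fun y => κ • V (x₀ + g • y) := fun θ y => by
  show κ • V (x₀ + g • rotZ θ y) = rotZ θ (κ • V (x₀ + g • y))
  rw [← rotZ_axis_add_smul h0 h1, hV θ, ← rotZL_apply, ← rotZL_apply, map_smul]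

/-- **A swirl-free slice stays swirl free under `y ↦ κ V(x₀ + g y)` with `x₀` on the axis** (`g ≠ 0`). [folklore] -/
theorem hasNoSwirl_smul_comp_axis {V : EuclideanSpace ℝ (Fin 3) → EuclideanSpace ℝ (Fin 3)} (hV : HasNoSwirl V)
    {x₀ : EuclideanSpace ℝ (Fin 3)} (h0 : x₀ 0 = 0) (h1 : x₀ 1 = 0) (κ : ℝ) {g : ℝ} (hg : g ≠ 0) :
    HasNoSwirl fun y => κ • V (x₀ + g • y) := fun y => by
  have h := hV (x₀ + g • y)
  simp only [swirl, PiLp.add_apply, PiLp.smul_apply, smul_eq_mul, h0, h1, zero_add] at h ⊢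
  have h' : g * (y 0 * V (x₀ + g • y) 1 - y 1 * V (x₀ + g • y) 0) = 0 := by linear_combination h
  have h'' : y 0 * V (x₀ + g • y) 1 - y 1 * V (x₀ + g • y) 0 = 0 := by
    rcases mul_eq_zero.1 h' with h | h
    · exact absurd h hg
    · exact h
  linear_combination κ * h''

/-! ## §3 The sterile door pulled back to kit units -/

/-- **THE STERILE MECHANISM DOOR IN KIT UNITS.** Let `hD : SterileDoorAt R C`. Given `ν' > 0`, `κ > 0`, a start time
`t_a`, a centre `x₀` ON THE AXIS, and a classical solution `(v, q)` of the unforced system with viscosity `ν'` on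
`[t_a, t_a + T]`, `T = κ² ν' · wfirstAt R`, whose release slice `v t_a` is AXISYMMETRIC SWIRL FREE, supported in `B̄(x₀, ρ)`
(`ρ ≥ 0`) with `κ ‖v t_a x‖ < Y₀(R)`, with finite energy, under the cap `κ ‖v t x‖ ≤ (5/3) Y₁(R) − η` (`η > 0`), showing at
`t_a + T` in `B̄(x₀, ρ)`: `Y₁(R) + η ≤ κ ‖v‖`, `A₁(R) + η ≤ κ²ν' ‖Dv‖`, and a `C¹` closed loop inside a ball of radius `κν'/N₁(R)`
with speed `≤ 8π κν'/N₁(R)` and circulation `≥ ν' (N₁(R)^{β−2} + η)`. Then `C`. Proof: ecbridge-3's rescaling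
`(s, y) ↦ κ v((t_a − κ²ν') + κ²ν' s, x₀ + κν' y)` verbatim, plus §2 for the sterility of the rescaled datum.
[cite: Leray1934, §20] [cite: Palasek2026ElementaryModel, §4] -/
theorem SterileDoorAt.of_scaledFreeRun {R : TowerRates} {C : Prop} (hD : SterileDoorAt R C)
    {ν' κ : ℝ} (hν' : 0 < ν') (hκ : 0 < κ) (t_a : ℝ) {x₀ : EuclideanSpace ℝ (Fin 3)} (hx₀ : x₀ 0 = 0 ∧ x₀ 1 = 0) {T : ℝ}
    (hT : T = κ ^ 2 * ν' * Host.wfirstAt R)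
    {v : ℝ → EuclideanSpace ℝ (Fin 3) → EuclideanSpace ℝ (Fin 3)} {q : ℝ → EuclideanSpace ℝ (Fin 3) → ℝ}
    (hv : IsClassicalNSSolutionOn (Icc t_a (t_a + T)) ν' 0 v q)
    (hax : IsAxisymmetric (v t_a)) (hsw : HasNoSwirl (v t_a))
    {ρ : ℝ} (hρ : 0 ≤ ρ) (hsupp : tsupport (v t_a) ⊆ closedBall x₀ ρ)
    (hlt : ∀ x, κ * ‖v t_a x‖ < R.Y 0)
    (hE : ∃ C : ℝ≥0∞, C < ⊤ ∧ ∀ t ∈ Icc t_a (t_a + T), ∫⁻ x, ‖v t x‖ₑ ^ 2 ≤ C)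
    {η : ℝ} (hη : 0 < η)
    (hcap : ∀ t ∈ Icc t_a (t_a + T), ∀ x, κ * ‖v t x‖ ≤ 5 / 3 * R.Y 1 - η)
    (hspeed : ∃ x, ‖x - x₀‖ ≤ ρ ∧ R.Y 1 + η ≤ κ * ‖v (t_a + T) x‖)
    (hstrain : ∃ x, ‖x - x₀‖ ≤ ρ ∧ R.A 1 + η ≤ κ ^ 2 * ν' * ‖fderiv ℝ (v (t_a + T)) x‖)
    (hcore : ∃ (x : EuclideanSpace ℝ (Fin 3)) (c : ℝ → EuclideanSpace ℝ (Fin 3)),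
      ‖x - x₀‖ ≤ ρ ∧ ContDiff ℝ 1 c ∧ c 0 = c 1 ∧
      (∀ s ∈ Icc (0 : ℝ) 1, c s ∈ closedBall x (κ * ν' / R.N 1)) ∧
      (∀ s ∈ Icc (0 : ℝ) 1, ‖deriv c s‖ ≤ 8 * Real.pi * (κ * ν') / R.N 1) ∧
      ν' * (R.N 1 ^ (R.β - 2) + η) ≤ circulation (v (t_a + T)) c) :
    C := by
  -- the parameters of the rescaling: dilation `g = κ ν'`, clock rate `b = κ g = κ² ν'`, clock origin `t₀ = t_a − b`
  set g : ℝ := κ * ν' with hg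
  have hgpos : 0 < g := mul_pos hκ hν'
  have hg0 : g ≠ 0 := hgpos.ne'
  set b : ℝ := κ * g with hb
  have hbpos : 0 < b := mul_pos hκ hgpos
  have hb2 : κ ^ 2 * ν' = b := by rw [hb, hg]; ring
  have hTb : T = b * Host.wfirstAt R := by rw [hT, hb2]
  set t₀ : ℝ := t_a - b with ht₀
  have hN1 : 0 < R.N 1 := R.N_pos 1
  have hclock1 : t₀ + b * 1 = t_a := by rw [ht₀]; ring
  have hclockT : t₀ + b * Host.τfirstAt R = t_a + T := by rw [Host.τfirstAt_eq, hTb, ht₀]; ring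
  have hS : (fun r => t₀ + b * r) ⁻¹' Icc t_a (t_a + T) = Icc 1 (Host.τfirstAt R) := by
    rw [Host.τfirstAt_eq, hTb, ht₀]
    exact preimage_clock_Icc hbpos
  have hmem : ∀ {s : ℝ}, s ∈ Icc 1 (Host.τfirstAt R) → t₀ + b * s ∈ Icc t_a (t_a + T) := by
    intro s hs
    have h := clock_mem_Icc (t_a := t_a) (w := Host.wfirstAt R) hbpos (s := s)
      (by rw [← Host.τfirstAt_eq]; exact hs)
    rw [hTb, ht₀]
    exact h
  have h1mem : (1 : ℝ) ∈ Icc 1 (Host.τfirstAt R) := ⟨le_rfl, (Host.one_lt_τfirstAt R).le⟩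
  have hτmem : Host.τfirstAt R ∈ Icc 1 (Host.τfirstAt R) := ⟨(Host.one_lt_τfirstAt R).le, le_rfl⟩
  -- the rescaled classical free run with viscosity `1` on `[1, τfirstAt R]`
  have key : IsClassicalNSSolutionOn (Icc 1 (Host.τfirstAt R)) 1 0 (κ • stPull b g t₀ x₀ v)
      (κ ^ 2 • stPull b g t₀ x₀ q) := by
    have h := hv.stRescale hκ hgpos hb t₀ x₀
    rw [hS, smul_stPull_zero, show κ * ν' / g = 1 from by rw [hg]; exact div_self hg0] at h
    exact h
  -- the datum `W = κ v(t_a, x₀ + g ·)`: sterile, smooth, divergence free, supported in `B̄(0, ρ/g)`, speed `< Y₀`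
  have hW1 : (κ • stPull b g t₀ x₀ v) 1 = fun y => κ • v t_a (x₀ + g • y) := by
    funext y
    rw [smul_stPull_apply, hclock1]
  have hWax : IsAxisymmetric ((κ • stPull b g t₀ x₀ v) 1) := by
    rw [hW1]; exact isAxisymmetric_smul_comp_axis hax hx₀.1 hx₀.2 κ g
  have hWsw : HasNoSwirl ((κ • stPull b g t₀ x₀ v) 1) := by
    rw [hW1]; exact hasNoSwirl_smul_comp_axis hsw hx₀.1 hx₀.2 κ hg0
  have hWsmooth : ContDiff ℝ ∞ ((κ • stPull b g t₀ x₀ v) 1) := key.contDiff_velocity h1mem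
  have hWdiv : VectorCalculus.IsDivFree ((κ • stPull b g t₀ x₀ v) 1) := key.divFree 1 h1mem
  have hWsupp : tsupport ((κ • stPull b g t₀ x₀ v) 1) ⊆ closedBall 0 (ρ / g) := by
    rw [hW1]
    refine closure_minimal (fun y hy => ?_) isClosed_closedBall
    have hy' : v t_a (x₀ + g • y) ≠ 0 := by
      intro h0
      exact hy (by simp [h0])
    have hmemsupp : x₀ + g • y ∈ closedBall x₀ ρ := hsupp (subset_tsupport _ hy')
    rw [mem_closedBall, dist_eq_norm, add_sub_cancel_left, norm_smul, Real.norm_of_nonneg hgpos.le] at hmemsupp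
    rw [mem_closedBall, dist_zero_right, le_div_iff₀ hgpos, mul_comm]
    exact hmemsupp
  have hWlt : ∀ y, ‖(κ • stPull b g t₀ x₀ v) 1 y‖ < R.Y 0 := by
    intro y
    rw [hW1]
    dsimp only
    rw [norm_smul, Real.norm_of_nonneg hκ.le]
    exact hlt _
  have hρ' : 0 ≤ ρ / g := div_nonneg hρ hgpos.le
  -- energy on the register window
  have hE' : ∃ C : ℝ≥0∞, C < ⊤ ∧ ∀ s ∈ Icc (1 : ℝ) (Host.τfirstAt R),
      ∫⁻ y, ‖(κ • stPull b g t₀ x₀ v) s y‖ₑ ^ 2 ≤ C := by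
    obtain ⟨C, hC, hCb⟩ := hE
    refine ⟨‖κ‖ₑ ^ 2 * (ENNReal.ofReal (g ^ Module.finrank ℝ (EuclideanSpace ℝ (Fin 3)))⁻¹ * C), ?_, ?_⟩
    · exact ENNReal.mul_lt_top (by simp) (ENNReal.mul_lt_top ENNReal.ofReal_lt_top hC)
    · intro s hs
      exact lintegral_enorm_sq_smul_stPull_le_of_le hgpos b t₀ x₀ v s (hCb _ (hmem hs))
  -- cap on the register window
  have hcap' : ∀ s ∈ Icc (1 : ℝ) (Host.τfirstAt R), ∀ y,
      ‖(κ • stPull b g t₀ x₀ v) s y‖ ≤ 5 / 3 * R.Y 1 - η := by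
    intro s hs y
    rw [smul_stPull_apply, norm_smul, Real.norm_of_nonneg hκ.le]
    exact hcap _ (hmem hs) _
  -- the readout slice at `τfirstAt R` is `κ v(t_a + T, x₀ + g ·)`
  have hWT : (κ • stPull b g t₀ x₀ v) (Host.τfirstAt R) = fun y => κ • v (t_a + T) (x₀ + g • y) := by
    funext y
    rw [smul_stPull_apply, hclockT]
  have hpt : ∀ {x : EuclideanSpace ℝ (Fin 3)}, ‖x - x₀‖ ≤ ρ →
      ‖g⁻¹ • (x - x₀)‖ ≤ ρ / g ∧ x₀ + g • (g⁻¹ • (x - x₀)) = x := by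
    intro x hx
    refine ⟨?_, ?_⟩
    · rw [norm_smul, Real.norm_of_nonneg (inv_nonneg.2 hgpos.le), inv_mul_eq_div]
      exact div_le_div_of_nonneg_right hx hgpos.le
    · rw [smul_smul, mul_inv_cancel₀ hg0, one_smul, add_sub_cancel]
  -- speed face
  have hspeed' : ∃ y, ‖y‖ ≤ ρ / g ∧ R.Y 1 + η ≤ ‖(κ • stPull b g t₀ x₀ v) (Host.τfirstAt R) y‖ := by
    obtain ⟨x, hx, hfl⟩ := hspeed
    refine ⟨g⁻¹ • (x - x₀), (hpt hx).1, ?_⟩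
    rw [hWT]
    dsimp only
    rw [(hpt hx).2, norm_smul, Real.norm_of_nonneg hκ.le]
    exact hfl
  -- gradient face
  have hstrain' : ∃ y, ‖y‖ ≤ ρ / g ∧
      R.A 1 + η ≤ ‖fderiv ℝ ((κ • stPull b g t₀ x₀ v) (Host.τfirstAt R)) y‖ := by
    obtain ⟨x, hx, hfl⟩ := hstrain
    refine ⟨g⁻¹ • (x - x₀), (hpt hx).1, ?_⟩
    have hdiff : Differentiable ℝ (v (t₀ + b * Host.τfirstAt R)) := by
      rw [hclockT]
      exact (hv.contDiff_velocity (hclockT ▸ hmem hτmem)).differentiable (by simp)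
    have hd : DifferentiableAt ℝ (stPull b g t₀ x₀ v (Host.τfirstAt R)) (g⁻¹ • (x - x₀)) :=
      differentiable_stPull_slice hdiff _
    have hfd : fderiv ℝ ((κ • stPull b g t₀ x₀ v) (Host.τfirstAt R)) (g⁻¹ • (x - x₀)) =
        κ • (g • fderiv ℝ (v (t_a + T)) x) := by
      rw [show (κ • stPull b g t₀ x₀ v) (Host.τfirstAt R) = κ • (stPull b g t₀ x₀ v (Host.τfirstAt R)) from rfl,
        fderiv_const_smul hd, fderiv_stPull, hclockT, (hpt hx).2]
    rw [hfd, norm_smul, norm_smul, Real.norm_of_nonneg hκ.le, Real.norm_of_nonneg hgpos.le, ← mul_assoc,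
      show κ * g = κ ^ 2 * ν' from by rw [hg]; ring]
    exact hfl
  -- core face: the pulled-back loop `s ↦ g⁻¹ (c s − x₀)`
  have hcore' : ∃ (y : EuclideanSpace ℝ (Fin 3)) (γ : ℝ → EuclideanSpace ℝ (Fin 3)),
      ‖y‖ ≤ ρ / g ∧ ContDiff ℝ 1 γ ∧ γ 0 = γ 1 ∧
      (∀ s ∈ Icc (0 : ℝ) 1, γ s ∈ closedBall y (1 / R.N 1)) ∧
      (∀ s ∈ Icc (0 : ℝ) 1, ‖deriv γ s‖ ≤ 8 * Real.pi / R.N 1) ∧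
      R.N 1 ^ (R.β - 2) + η ≤ circulation ((κ • stPull b g t₀ x₀ v) (Host.τfirstAt R)) γ := by
    obtain ⟨x, c, hx, hc1, hc01, hball, hspd, hcirc⟩ := hcore
    refine ⟨g⁻¹ • (x - x₀), fun s => g⁻¹ • (c s - x₀), (hpt hx).1, ?_, ?_, ?_, ?_, ?_⟩
    · exact (hc1.sub contDiff_const).const_smul _
    · simp only [hc01]
    · intro s hs
      have h := hball s hs
      rw [mem_closedBall, dist_eq_norm] at h ⊢
      rw [← smul_sub, sub_sub_sub_cancel_right, norm_smul, Real.norm_of_nonneg (inv_nonneg.2 hgpos.le)]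
      calc g⁻¹ * ‖c s - x‖ ≤ g⁻¹ * (κ * ν' / R.N 1) := mul_le_mul_of_nonneg_left h (inv_nonneg.2 hgpos.le)
        _ = 1 / R.N 1 := by rw [← hg]; field_simp
    · intro s hs
      have h := hspd s hs
      rw [deriv_fun_const_smul_field, deriv_sub_const, norm_smul, Real.norm_of_nonneg (inv_nonneg.2 hgpos.le)]
      calc g⁻¹ * ‖deriv c s‖ ≤ g⁻¹ * (8 * Real.pi * (κ * ν') / R.N 1) :=
            mul_le_mul_of_nonneg_left h (inv_nonneg.2 hgpos.le)
        _ = 8 * Real.pi / R.N 1 := by rw [← hg]; field_simp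
    · rw [hWT, circulation_smul_affine_pullback hg0 x₀ (v (t_a + T)) c,
        show κ / g = ν'⁻¹ from by rw [hg, ← div_div, div_self hκ.ne', one_div]]
      rw [inv_mul_eq_div, le_div_iff₀ hν', mul_comm]
      exact hcirc
  -- close by the sterile door
  exact hD hWax hWsw hWsmooth hWdiv hWsupp hWlt hρ' key rfl hE' hη hcap' hspeed' hstrain' hcore'

end Summit.NavierStokesRegularity.FluidComputer.PalasekTowerClayBridge.StrainDoor

end
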